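import Literature.MathematicalPhysics.QuantumFieldTheory.BalabanImbrieJaffe1984to88.BIJ88Eq5128Display

/-!
# `BalabanImbrieJaffe1984to88.BIJ88InteriorFibration46` — T. Bałaban, J. Imbrie, A. Jaffe, *Effective action and cluster properties of the
abelian Higgs model*, Commun. Math. Phys. **114** (1988) 257–315 [BalabanImbrieJaffe1988], **(4.6)** p. 275 [PDF 19] (*"δ_{Λ^{(j)′c*c}_{10}}(QΛ^{(j)c*c}_{10}A)
… the subscripts to δ_{Ax} and δ(QA) indicate which blocks have axial gauge conditions and which block bonds have conditions on QA"*), **(5.12.7)**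
p. 302 [PDF 46] (*"dA^{(k)″}|_{Λ^{(k)c*c}_{10}} … δ_{Ax,Λ^{(k)′}_{10}}(A^{(k)″}) δ_{Λ^{(k)′c*c}_{10}}(QΛ^{(k)c*c}_{10}A^{(k)″})"*) with **(5.3.6)** p. 280 [PDF 24] (*"δ(v/Qu) =
δ_{Λ₁^{(k)′*c}}(v/Qu) δ_{Λ₁^{(k)′*}}((e_k/2π)QA′)"*) — **THE BLOCK-AVERAGE CONSTRAINTS OF AN INTERIOR GAUGE FIBRE AT MEASURE LEVEL, GROUP LEVEL:
under any law of the bond variables invariant under the substitutions `u ↦ u·Q^{s*}w` SUPPORTED ON A SET `C` OF BLOCK BONDS, the translated variable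
`u′_C` and the `C`-components of `Qu` are independent, the latter Haar — in particular on the interior fibre of the Sect. 5.12 conditioning with the
exterior bond variables FROZEN (PROVED).**

statement-level skeleton of published theorems with citation tags; proofs where landed; nothing here is a claim about the Yang–Mills mass gap

WHY (HOME/GAPS.md G-C2-23, the gauge half of the recorded flip condition of row C2.Eq5.12.8).  The interior law `dμ^{(k)}_{Λ₁₀}` of (5.12.7) integrates
the translated interior variables `A^{(k)″}` against `dA″ δ_{Ax}(A″) δ_{Λ′^{c*c}_{10}}(QΛ^{c*c}_{10}A″)`: Lebesgue measure on the affine set cut out by the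
interior block-average constraints.  In the tree's frame (`BIJ88Eq5128Frame.isDC_of_isDT`) the interior variables are the UNTRANSLATED bond variables
`u|_{Λ^{c*c}_{10}}` under the product of one-bond laws (`Interior.μIU`), read by the bracket through the translation `u′_Λ(u) = u·Q^{s*}(cut-off·(Qu)⁻¹)`
(`uCut`).  Gen 7 of this seat proved ON THE WHOLE TORUS that under every substitution-invariant law the pair `(u′_Λ, cut-off_Λ·Qu)` has the product
law `law(u′_Λ) ⊗ (cut-off)_* dv` (`BIJ88Eq531TranslLawCutoff.map_graphCut_eq_prod`) — the measure-level content of the `δ`-function calculus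
(4.6)/(5.3.6).  THIS FILE localizes it to an interior fibre: p. 266 [PDF 10] *"We denote by X* the set of bonds with both endpoints in X … Thus X^{c*c}
includes bonds with one or both endpoints in X"* — the interior bond set `Λ^{(k)c*c}_{10}` is the FAT one, so the surface (crossing) bonds of every
block bond `c ∈ Λ^{(k)′c*c}_{10}` (at least one endpoint block in `Λ′_{10}`) are interior, and the substitutions `u ↦ u·Q^{s*}w` with `w` supported on
such a `C` move interior variables only: the glued fibre law (exterior variables frozen at ANY value) is invariant under them.
 §1 ON THE TORUS, LOCAL INVARIANCE: for a probability law `ν` with `ν ∘ (u ↦ u·Q^{s*}(cut-off_C·w))⁻¹ = ν` for all `w` (weaker than gen 7's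
    hypothesis, which asks it for every `w`; `localInvariant_of_invariant`): `lintegral_cutoff_qU_eq_local`, **`map_graphCut_eq_prod_local`**
    (`law(u′_C, cut-off_C·Qu) = law(u′_C) ⊗ (cut-off_C)_* dv`), `measurePreserving_graphCut_local`, and the factorized integrals
    **`lintegral_mul_comp_qU_local`** / **`integral_mul_comp_qU_local`**: `∫ν F(u′_C(u))·G(cut-off_C·Qu) = (∫ν F(u′_C)) · (∫dv G(cut-off_C·v))` — gen 7's
    proof verbatim with the weaker hypothesis (Haar invariance of `dv`, Tonelli, `Q(u·Q^{s*}w) = (Qu)·w`).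
 §2 THE INTERIOR FIBRE of this seat's `BIJ88Eq5128Split.Interior` `D`: the glued law `fibreLaw D m e = (glue_e)_*(Π_{b∈Ib} m_b)` of the bond field with
    the exterior variables frozen at `e`; **`fibreLaw_map_surfMul_cutoff`** — it is locally invariant as soon as (i) every surface bond of every `c ∈ C`
    is interior (`hC`, the fat-interior geometry above) and (ii) the one-bond laws on those bonds are right-invariant (`hm`; automatic for `du_b`, and
    for `axialLaw` because surface bonds are not axial tree bonds: `axialLaw_map_mul_right`); hence **`map_graphCut_fibreLaw`**,
    **`lintegral_fibre_mul_comp_qU`** / **`integral_fibre_mul_comp_qU`**: over the interior fibre, `∫ F(u′_C(u_e(i)))·G(cut-off_C·Q(u_e(i))) dμIU(i) =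
    (∫ F(u′_C(u_e(i))) dμIU) · ∫dv G(cut-off_C·v)` — *"δ_{Λ′^{c*c}_{10}}(QΛ^{c*c}_{10}A″)"*: the interior block averages are free Haar variables
    decoupled from the constrained (translated) interior configuration.
 §3 BOOKKEEPING for the consumer (`BIJ88Eq5127GaugeSector`): `uCut_eq_uCut_of_mem` — on interior bonds the term's translation `u′_Λ` (cut-off
    `Λ = Λ₁^{(k)′*} ⊇ C`) agrees with `u′_C` when the interior surface bonds with coarse bond in `Λ` have it in `C` — and the pointwise `uCut_apply`.
HONEST SCOPE.  Group-level identities of measures only: no chart, no linearization of `Q` ((2.13)), no identification of `law(u′_C)` with Lebesgue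
measure on the constraint subspace (the Jacobian bookkeeping *"removal of the e_k/2π factor from the δ-functions"* of (5.12.3) and the count (4.8)) —
those are the companion files `BIJ88InteriorHaarChart` (chart) / `BIJ88FreeCoordinates48` (linear algebra) and the assembly.  0 `sorry`, no
`Prop`-valued fact, standard axioms.
Seat p34 gen 12, file G3 (own lineage = the C1/C2 renormalization-transformation line at measure level; TAKING line HOME/STATUS.md 2026-08-22T07:19Z).

CITATION HEADER (lean-in-tree rule).  Part of the lit-balaban TYPED SKELETON (HOME `run/shared/lean/pub/lit-balaban/`), PHASE-2 proof seat p34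
gen 12 (unit `lit-balaban-p34-g12`).  Rows served: support of **`C2.Eq5.12.8`** (gauge half of the recorded flip condition, *"the free-coordinate
parametrization of the δ-constraints"*) and **`C2.Eq5.12.1-5.12.7`** ((5.12.7) `δ_{Λ′^{c*c}_{10}}(QΛ^{c*c}A″)`) of `HOME/lit-balaban-r16/ROWS-C2-part2.md`
(owner r16); cross-reference `C2.Eq4.6` (owner r18) and `C2.Eq5.3.1-5.3.7` ((5.3.6)).  Built BY NAME on gen 7's `BIJ88Eq531TranslLaw(Cutoff)`
(`surfMul_surfMul`, `uCut_surfMul_cutoff`, `measurable_uCut`, `measurable_graphCut`), r18's `BIJ85BlockAveragesTorus` (`qU`, `surfMul`, `qU_surfMul`,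
`IsCross`, `coarse`), p31's `BIJ88Eq536Linearization.cutoff`, this seat's `BIJ88Eq5128Split` (`Interior`, `μIU`, `splitU`) and `BIJ88Eq596Display.uCut`;
nothing restated.  PDF held: `paper:balaban1988-cmp114-bij-abelian-higgs-effective-action` (journal page = PDF page + 256); pp. 266, 275, 280, 302
read this session (p. 266 text layer; pp. 275/280/302 as images).  Imports Literature + Mathlib only.
-/

namespace Literature.MathematicalPhysics.QuantumFieldTheory.BalabanImbrieJaffe1984to88.BIJ88InteriorFibration46

open Literature.MathematicalPhysics.QuantumFieldTheory.Balaban1983to89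
open BIJ88Sect3Statements (U1)
open BIJ88RenormTransf311 (axialBonds mem_axialBonds)
open BIJ85BlockAveragesTorus (qU surfMul surfFactor IsCross coarse qU_surfMul measurable_qU measurable_surfMul surfMul_of_not_isCross)
open BIJ88Eq536Linearization (cutoff)
open BIJ88Eq531TranslLaw (surfMul_surfMul surfMul_one measurable_surfMul₂)
open BIJ88Eq531TranslLawCutoff (cutoff_apply measurable_cutoff uCut_surfMul_cutoff measurable_uCut measurable_graphCut)
open BIJ88Eq596Display (uCut uCut_def)
open BIJ88Eq5128Split (Interior UCfg)
open BIJ88Eq5128Display (axialLaw)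
open scoped BigOperators ENNReal
open _root_.MeasureTheory _root_.MeasureTheory.Measure Function

noncomputable section

/-! ## §1 Local substitution invariance on the torus -/

section Local

variable {P : Params} {j : ℕ} {Λ : Finset (PBond P (j+1))}
variable {ν : Measure (GaugeField P j U1)} [IsProbabilityMeasure ν]

omit [IsProbabilityMeasure ν] in
/-- **Local substitution invariance from global**: a law invariant under every substitution `u ↦ u·Q^{s*}w` (gen 7's hypothesis; `𝒟u`, `𝒟u δ_{Ax}`) is
invariant under those supported on `Λ`. [cite: BalabanImbrieJaffe1988, (5.3.6) p.280] -/
theorem localInvariant_of_invariant (hν : ∀ w, ν.map (fun U => surfMul U w) = ν) (w : GaugeField P (j+1) U1) :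
    ν.map (fun U => surfMul U (cutoff Λ w)) = ν :=
  hν (cutoff Λ w)

omit [IsProbabilityMeasure ν] in
/-- kernel: under a locally invariant law, `∫ν F(u·Q^{s*}(cut-off·w)) = ∫ν F(u)`. [cite: BalabanImbrieJaffe1988, (5.3.6) p.280] -/
theorem lintegral_comp_surfMul_cutoff (hν : ∀ w, ν.map (fun U => surfMul U (cutoff Λ w)) = ν) (w : GaugeField P (j+1) U1)
    {F : GaugeField P j U1 → ℝ≥0∞} (hF : Measurable F) : ∫⁻ U, F (surfMul U (cutoff Λ w)) ∂ν = ∫⁻ U, F U ∂ν := by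
  calc ∫⁻ U, F (surfMul U (cutoff Λ w)) ∂ν = ∫⁻ U, F U ∂(ν.map fun U => surfMul U (cutoff Λ w)) :=
        (lintegral_map hF (measurable_surfMul (cutoff Λ w))).symm
    _ = ∫⁻ U, F U ∂ν := by rw [hν w]

/-- **AVERAGING OUT THE `C`-COMPONENTS OF THE BLOCK FIELD, LOCAL FORM** (gen 7's `lintegral_cutoff_qU_eq` under the weaker hypothesis): for `ν` invariant
under the substitutions supported on `Λ` and a jointly measurable `J(u, v) ≥ 0` with `J(u·Q^{s*}(cut-off·w), ·) = J(u, ·)`: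
`∫ν J(u, cut-off·Qu) = ∫ν ∫dv J(u, cut-off·v)`. [cite: BalabanImbrieJaffe1988, (5.3.6) p.280] -/
theorem lintegral_cutoff_qU_eq_local (hj : j + 1 ≤ P.m + P.K) (hν : ∀ w, ν.map (fun U => surfMul U (cutoff Λ w)) = ν)
    {J : GaugeField P j U1 → GaugeField P (j+1) U1 → ℝ≥0∞} (hJ : Measurable (uncurry J))
    (hJinv : ∀ U w, J (surfMul U (cutoff Λ w)) = J U) :
    ∫⁻ U, J U (cutoff Λ (qU U)) ∂ν = ∫⁻ U, ∫⁻ v, J U (cutoff Λ v) ∂fieldMeasure P (j+1) U1 ∂ν := by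
  have hJU : ∀ U, Measurable (J U) := fun U => hJ.comp measurable_prodMk_left
  have hm1 : Measurable fun p : GaugeField P j U1 × GaugeField P (j+1) U1 => J p.1 (cutoff Λ (fun c => qU p.1 c * p.2 c)) := by
    have h : Measurable fun p : GaugeField P j U1 × GaugeField P (j+1) U1 => (p.1, cutoff Λ (fun c => qU p.1 c * p.2 c)) :=
      measurable_fst.prodMk ((measurable_cutoff Λ).comp (measurable_pi_iff.mpr fun c =>
        ((measurable_pi_apply c).comp (measurable_qU.comp measurable_fst)).mul ((measurable_pi_apply c).comp measurable_snd)))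
    exact hJ.comp h
  have hm2 : Measurable fun U : GaugeField P j U1 => J U (cutoff Λ (qU U)) :=
    hJ.comp (measurable_id.prodMk ((measurable_cutoff Λ).comp measurable_qU))
  symm
  calc ∫⁻ U, ∫⁻ v, J U (cutoff Λ v) ∂fieldMeasure P (j+1) U1 ∂ν
      = ∫⁻ U, ∫⁻ w, J U (cutoff Λ (fun c => qU U c * w c)) ∂fieldMeasure P (j+1) U1 ∂ν := by
        refine lintegral_congr fun U => ?_
        exact ((AveragingRT.measurePreserving_mulLeft (P := P) (j := j+1) (G := U1) (qU U)).lintegral_comp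
          ((hJU U).comp (measurable_cutoff Λ))).symm
    _ = ∫⁻ w, ∫⁻ U, J U (cutoff Λ (fun c => qU U c * w c)) ∂ν ∂fieldMeasure P (j+1) U1 :=
        lintegral_lintegral_swap hm1.aemeasurable
    _ = ∫⁻ w, ∫⁻ U, J (surfMul U (cutoff Λ w)) (cutoff Λ (qU (surfMul U (cutoff Λ w)))) ∂ν ∂fieldMeasure P (j+1) U1 := by
        refine lintegral_congr fun w => lintegral_congr fun U => ?_
        rw [qU_surfMul hj, hJinv]
        congr 1
        funext c
        by_cases hc : c ∈ Λ <;> simp [cutoff_apply, hc]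
    _ = ∫⁻ w, ∫⁻ U, J U (cutoff Λ (qU U)) ∂ν ∂fieldMeasure P (j+1) U1 := by
        refine lintegral_congr fun w => ?_
        exact lintegral_comp_surfMul_cutoff hν w hm2
    _ = ∫⁻ U, J U (cutoff Λ (qU U)) ∂ν := by
        rw [lintegral_const, measure_univ, mul_one]

/-- **`law(u′_C, cut-off_C·Qu) = law(u′_C) ⊗ (cut-off_C)_* dv` UNDER LOCAL INVARIANCE** — the translated variable and the `C`-components of the block
field are independent, the latter Haar: the measure-level content of *"δ_{Λ′^{c*c}_{10}}(QΛ^{c*c}_{10}A)"* for a law invariant only under the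
substitutions supported on `C` (an interior fibre with frozen exterior, §2). [cite: BalabanImbrieJaffe1988, (4.6) p.275] -/
theorem map_graphCut_eq_prod_local (hj : j + 1 ≤ P.m + P.K) (hν : ∀ w, ν.map (fun U => surfMul U (cutoff Λ w)) = ν) :
    ν.map (fun U => (surfMul U (cutoff Λ (fun c => (qU U c)⁻¹)), cutoff Λ (qU U))) =
      (ν.map fun U => surfMul U (cutoff Λ (fun c => (qU U c)⁻¹))).prod ((fieldMeasure P (j+1) U1).map (cutoff Λ)) := by
  haveI : IsProbabilityMeasure (ν.map fun U : GaugeField P j U1 => surfMul U (cutoff Λ (fun c => (qU U c)⁻¹))) :=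
    Measure.isProbabilityMeasure_map (measurable_uCut Λ).aemeasurable
  haveI : IsProbabilityMeasure ((fieldMeasure P (j+1) U1).map (cutoff Λ)) :=
    Measure.isProbabilityMeasure_map (measurable_cutoff Λ).aemeasurable
  ext S hS
  rw [Measure.map_apply (measurable_graphCut Λ) hS, Measure.prod_apply hS,
    lintegral_map (measurable_measure_prodMk_left hS) (measurable_uCut Λ), ← lintegral_indicator_one ((measurable_graphCut Λ) hS)]
  have e1 : ∀ U : GaugeField P j U1,
      ((fun U => (surfMul U (cutoff Λ (fun c => (qU U c)⁻¹)), cutoff Λ (qU U))) ⁻¹' S).indicator (1 : GaugeField P j U1 → ℝ≥0∞) U =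
        S.indicator 1 (surfMul U (cutoff Λ (fun c => (qU U c)⁻¹)), cutoff Λ (qU U)) := fun U => rfl
  have e2 : ∀ U : GaugeField P j U1, ((fieldMeasure P (j+1) U1).map (cutoff Λ)) (Prod.mk (surfMul U (cutoff Λ (fun c => (qU U c)⁻¹))) ⁻¹' S) =
      ∫⁻ v, S.indicator 1 (surfMul U (cutoff Λ (fun c => (qU U c)⁻¹)), cutoff Λ v) ∂fieldMeasure P (j+1) U1 := fun U => by
    rw [Measure.map_apply (measurable_cutoff Λ) (measurable_prodMk_left hS),
      ← lintegral_indicator_one ((measurable_cutoff Λ) (measurable_prodMk_left hS))]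
    rfl
  simp_rw [e1, e2]
  refine lintegral_cutoff_qU_eq_local hj hν (J := fun U v => S.indicator 1 (surfMul U (cutoff Λ (fun c => (qU U c)⁻¹)), v)) ?_ ?_
  · exact (measurable_const.indicator hS).comp (((measurable_uCut Λ).comp measurable_fst).prodMk measurable_snd)
  · intro U w
    funext v
    show S.indicator 1 (surfMul (surfMul U (cutoff Λ w)) (cutoff Λ (fun c => (qU (surfMul U (cutoff Λ w)) c)⁻¹)), v) =
      S.indicator 1 (surfMul U (cutoff Λ (fun c => (qU U c)⁻¹)), v)
    rw [uCut_surfMul_cutoff hj]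

/-- `u ↦ (u′_C, cut-off_C·Qu)` is measure preserving `ν → law(u′_C) ⊗ (cut-off)_*dv` under local invariance. [cite: BalabanImbrieJaffe1988, (4.6) p.275] -/
theorem measurePreserving_graphCut_local (hj : j + 1 ≤ P.m + P.K) (hν : ∀ w, ν.map (fun U => surfMul U (cutoff Λ w)) = ν) :
    MeasurePreserving (fun U => (surfMul U (cutoff Λ (fun c => (qU U c)⁻¹)), cutoff Λ (qU U))) ν
      ((ν.map fun U => surfMul U (cutoff Λ (fun c => (qU U c)⁻¹))).prod ((fieldMeasure P (j+1) U1).map (cutoff Λ))) :=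
  ⟨measurable_graphCut Λ, map_graphCut_eq_prod_local hj hν⟩

/-- kernel: the translated variable of gens 7–9 is `uCut qU Λ` (name of `BIJ88Eq596Display`). [cite: BalabanImbrieJaffe1988, (5.3.1) p.280] -/
theorem uCut_qU_eq (U : GaugeField P j U1) : uCut qU Λ U = surfMul U (cutoff Λ (fun c => (qU U c)⁻¹)) := rfl

/-- **FACTORIZED INTEGRALS (`ℝ≥0∞`)**: `∫ν F(u′_C(u))·G(cut-off_C·Qu) = (∫ν F(u′_C(u))) · ∫dv G(cut-off_C·v)` for measurable `F, G ≥ 0` — the block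
averages inside `C` are free Haar variables independent of the translated configuration. [cite: BalabanImbrieJaffe1988, (4.6) p.275] -/
theorem lintegral_mul_comp_qU_local (hj : j + 1 ≤ P.m + P.K) (hν : ∀ w, ν.map (fun U => surfMul U (cutoff Λ w)) = ν)
    {F : GaugeField P j U1 → ℝ≥0∞} (hF : Measurable F) {G : GaugeField P (j+1) U1 → ℝ≥0∞} (hG : Measurable G) :
    ∫⁻ U, F (uCut qU Λ U) * G (cutoff Λ (qU U)) ∂ν = (∫⁻ U, F (uCut qU Λ U) ∂ν) * ∫⁻ v, G (cutoff Λ v) ∂fieldMeasure P (j+1) U1 := by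
  have hmp := measurePreserving_graphCut_local (Λ := Λ) hj hν
  have hFG : Measurable fun p : GaugeField P j U1 × GaugeField P (j+1) U1 => F p.1 * G p.2 :=
    (hF.comp measurable_fst).mul (hG.comp measurable_snd)
  have h1 := hmp.lintegral_comp hFG
  calc ∫⁻ U, F (uCut qU Λ U) * G (cutoff Λ (qU U)) ∂ν
      = ∫⁻ p, F p.1 * G p.2 ∂(ν.map fun U => surfMul U (cutoff Λ (fun c => (qU U c)⁻¹))).prod ((fieldMeasure P (j+1) U1).map (cutoff Λ)) :=
        h1
    _ = (∫⁻ x, F x ∂ν.map fun U => surfMul U (cutoff Λ (fun c => (qU U c)⁻¹))) * ∫⁻ y, G y ∂(fieldMeasure P (j+1) U1).map (cutoff Λ) :=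
        lintegral_prod_mul hF.aemeasurable hG.aemeasurable
    _ = (∫⁻ U, F (uCut qU Λ U) ∂ν) * ∫⁻ v, G (cutoff Λ v) ∂fieldMeasure P (j+1) U1 := by
        rw [lintegral_map hF (measurable_uCut Λ), lintegral_map hG (measurable_cutoff Λ)]
        rfl

/-- **FACTORIZED INTEGRALS (Bochner, `ℂ`-valued)**: `∫ν F(u′_C(u))·G(cut-off_C·Qu) = (∫ν F(u′_C(u))) · ∫dv G(cut-off_C·v)` for `F ∘ u′_C` integrable and
`G ∘ cut-off` integrable (`integral_prod_mul` through the measure-preserving graph map). [cite: BalabanImbrieJaffe1988, (4.6) p.275] -/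
theorem integral_mul_comp_qU_local (hj : j + 1 ≤ P.m + P.K) (hν : ∀ w, ν.map (fun U => surfMul U (cutoff Λ w)) = ν)
    {F : GaugeField P j U1 → ℂ} (hF : AEStronglyMeasurable F (ν.map fun U => surfMul U (cutoff Λ (fun c => (qU U c)⁻¹))))
    {G : GaugeField P (j+1) U1 → ℂ} (hG : AEStronglyMeasurable G ((fieldMeasure P (j+1) U1).map (cutoff Λ))) :
    ∫ U, F (uCut qU Λ U) * G (cutoff Λ (qU U)) ∂ν = (∫ U, F (uCut qU Λ U) ∂ν) * ∫ v, G (cutoff Λ v) ∂fieldMeasure P (j+1) U1 := by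
  have hmp := measurePreserving_graphCut_local (Λ := Λ) hj hν
  have hFG : AEStronglyMeasurable (fun p : GaugeField P j U1 × GaugeField P (j+1) U1 => F p.1 * G p.2)
      ((ν.map fun U => surfMul U (cutoff Λ (fun c => (qU U c)⁻¹))).prod ((fieldMeasure P (j+1) U1).map (cutoff Λ))) :=
    (hF.comp_fst).mul (hG.comp_snd)
  have h1 : ∫ U, F (uCut qU Λ U) * G (cutoff Λ (qU U)) ∂ν =
      ∫ p, F p.1 * G p.2 ∂(ν.map fun U => surfMul U (cutoff Λ (fun c => (qU U c)⁻¹))).prod ((fieldMeasure P (j+1) U1).map (cutoff Λ)) := by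
    rw [← hmp.map_eq, integral_map hmp.measurable.aemeasurable]
    · rfl
    · rw [hmp.map_eq]; exact hFG
  rw [h1, integral_prod_mul, integral_map (measurable_uCut Λ).aemeasurable hF, integral_map (measurable_cutoff Λ).aemeasurable hG]
  rfl

end Local

/-! ## §2 The interior fibre of the Sect. 5.12 conditioning: exterior bond variables frozen -/

section Fibre

open BIJ88Eq5128Split.Interior

attribute [local instance 1001] Subtype.fintype

variable {P : Params} {k : ℕ} (D : Interior P k) (m : PBond P k → Measure U1)

/-- **The bond field glued from frozen exterior variables `e` and interior variables `i`** (`splitU⁻¹ (e, i)` of `BIJ88Eq5128Split`).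
[cite: BalabanImbrieJaffe1988, (5.12.8) p.303] -/
def glueU (e : D.EU) (i : D.IU) : GaugeField P k U1 := D.splitU.symm (e, i)

/-- kernel: the value of the glued field. [cite: BalabanImbrieJaffe1988, (5.12.8) p.303] -/
theorem glueU_apply (e : D.EU) (i : D.IU) (b : PBond P k) :
    glueU D e i b = if h : b ∈ D.Ib then i ⟨b, h⟩ else e ⟨b, h⟩ := rfl

/-- kernel: on an interior bond the glued field is the interior variable. [cite: BalabanImbrieJaffe1988, (5.12.8) p.303] -/
theorem glueU_apply_of_mem (e : D.EU) (i : D.IU) {b : PBond P k} (hb : b ∈ D.Ib) : glueU D e i b = i ⟨b, hb⟩ := by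
  rw [glueU_apply, dif_pos hb]

/-- kernel: on an exterior bond the glued field is the frozen exterior variable. [cite: BalabanImbrieJaffe1988, (5.12.8) p.303] -/
theorem glueU_apply_of_not_mem (e : D.EU) (i : D.IU) {b : PBond P k} (hb : b ∉ D.Ib) : glueU D e i b = e ⟨b, hb⟩ := by
  rw [glueU_apply, dif_neg hb]

/-- kernel: gluing is jointly measurable. [cite: BalabanImbrieJaffe1988, (5.12.8) p.303] -/
theorem measurable_glueU₂ : Measurable fun p : D.EU × D.IU => glueU D p.1 p.2 := by
  refine measurable_pi_iff.mpr fun b => ?_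
  by_cases hb : b ∈ D.Ib
  · simp only [glueU_apply, dif_pos hb]
    exact (measurable_pi_apply _).comp measurable_snd
  · simp only [glueU_apply, dif_neg hb]
    exact (measurable_pi_apply _).comp measurable_fst

/-- kernel: gluing at frozen exterior variables is measurable in the interior variables. [cite: BalabanImbrieJaffe1988, (5.12.8) p.303] -/
theorem measurable_glueU (e : D.EU) : Measurable (glueU D e) :=
  (measurable_glueU₂ D).comp (measurable_const.prodMk measurable_id)

/-- **The interior gauge fibre law with frozen exterior**: the image of `Π_{b∈Ib} m_b` (`Interior.μIU`) under gluing at `e` — a law on the whole bond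
field. [cite: BalabanImbrieJaffe1988, (5.12.7) p.302] -/
def fibreLaw (e : D.EU) : Measure (GaugeField P k U1) := (D.μIU m).map (glueU D e)

/-- kernel: the fibre law is a probability measure (one-bond laws of mass one). [cite: BalabanImbrieJaffe1988, (5.12.7) p.302] -/
instance isProbabilityMeasure_fibreLaw [∀ b, IsProbabilityMeasure (m b)] (e : D.EU) : IsProbabilityMeasure (fibreLaw D m e) := by
  unfold fibreLaw BIJ88Eq5128Split.Interior.μIU
  exact Measure.isProbabilityMeasure_map (measurable_glueU D e).aemeasurable

/-- kernel: integration against the fibre law is integration over the interior fibre. [cite: BalabanImbrieJaffe1988, (5.12.7) p.302] -/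
theorem lintegral_fibreLaw (e : D.EU) {F : GaugeField P k U1 → ℝ≥0∞} (hF : Measurable F) :
    ∫⁻ U, F U ∂fibreLaw D m e = ∫⁻ i, F (glueU D e i) ∂D.μIU m :=
  lintegral_map hF (measurable_glueU D e)

/-- kernel: the same for Bochner integrals. [cite: BalabanImbrieJaffe1988, (5.12.7) p.302] -/
theorem integral_fibreLaw (e : D.EU) {E : Type*} [NormedAddCommGroup E] [NormedSpace ℝ E] {F : GaugeField P k U1 → E}
    (hF : AEStronglyMeasurable F (fibreLaw D m e)) : ∫ U, F U ∂fibreLaw D m e = ∫ i, F (glueU D e i) ∂D.μIU m :=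
  integral_map (measurable_glueU D e).aemeasurable hF

/-- **The interior substitution on the fibre**: multiply the interior variables by the surface factor of `cut-off_C·w`.
[cite: BalabanImbrieJaffe1988, (5.12.4) p.301] -/
def mulInt (C : Finset (PBond P (k+1))) (w : GaugeField P (k+1) U1) (i : D.IU) : D.IU :=
  fun b => i b * surfFactor (cutoff C w) b.1

/-- kernel: the surface factor of a substitution supported on `C` is trivial off the surface bonds of `C`. [cite: BalabanImbrieJaffe1988, (5.3.1) p.280] -/
theorem surfFactor_cutoff_eq_one {C : Finset (PBond P (k+1))} (w : GaugeField P (k+1) U1) {b : PBond P k}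
    (hb : ¬ (IsCross b ∧ coarse b ∈ C)) : surfFactor (cutoff C w) b = 1 := by
  unfold BIJ85BlockAveragesTorus.surfFactor
  by_cases hc : IsCross b
  · rw [if_pos hc, cutoff_apply]
    have hn : coarse b ∉ C := fun h => hb ⟨hc, h⟩
    rw [if_neg hn]
  · rw [if_neg hc]

variable {D m}

/-- **A substitution supported on `C` moves interior variables only** when every surface bond of every `c ∈ C` is interior (`hC`): glued field ·
`Q^{s*}(cut-off_C·w)` = glued field of the substituted interior variables. [cite: BalabanImbrieJaffe1988, (5.12.4) p.301] -/
theorem surfMul_glueU {C : Finset (PBond P (k+1))} (hC : ∀ b : PBond P k, IsCross b → coarse b ∈ C → b ∈ D.Ib)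
    (e : D.EU) (i : D.IU) (w : GaugeField P (k+1) U1) : surfMul (glueU D e i) (cutoff C w) = glueU D e (mulInt D C w i) := by
  funext b
  unfold BIJ85BlockAveragesTorus.surfMul
  by_cases hb : b ∈ D.Ib
  · rw [glueU_apply_of_mem D e i hb, glueU_apply_of_mem D e _ hb]
    rfl
  · rw [glueU_apply_of_not_mem D e i hb, glueU_apply_of_not_mem D e _ hb,
      surfFactor_cutoff_eq_one w (fun h => hb (hC b h.1 h.2)), mul_one]

/-- **The interior product law is invariant under the interior substitution** when the one-bond laws on the surface bonds of `C` are right-invariant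
(`hm`). [cite: BalabanImbrieJaffe1988, (5.12.7) p.302] -/
theorem map_mulInt_μIU [∀ b, IsProbabilityMeasure (m b)] {C : Finset (PBond P (k+1))}
    (hm : ∀ b ∈ D.Ib, IsCross b → coarse b ∈ C → ∀ g : U1, (m b).map (· * g) = m b) (w : GaugeField P (k+1) U1) :
    (D.μIU m).map (mulInt D C w) = D.μIU m := by
  unfold BIJ88Eq5128Split.Interior.μIU mulInt
  refine (measurePreserving_pi (fun b : {b : PBond P k // b ∈ D.Ib} => m b.1) (fun b => m b.1)
    (f := fun b x => x * surfFactor (cutoff C w) b.1) fun b => ⟨measurable_mul_const _, ?_⟩).map_eq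
  by_cases h : IsCross b.1 ∧ coarse b.1 ∈ C
  · exact hm b.1 b.2 h.1 h.2 _
  · rw [surfFactor_cutoff_eq_one w h]
    simp only [mul_one]
    exact Measure.map_id

/-- **THE GLUED FIBRE LAW IS LOCALLY SUBSTITUTION-INVARIANT** — for any frozen exterior `e`: `(fibreLaw e) ∘ (u ↦ u·Q^{s*}(cut-off_C·w))⁻¹ = fibreLaw e`,
given (i) the surface bonds of `C` are interior (`hC`: the fat interior `Λ^{c*c}_{10}` of p. 266 contains the surface bonds of every block bond with an
endpoint block in `Λ′_{10}`) and (ii) right-invariance of their one-bond laws (`hm`). [cite: BalabanImbrieJaffe1988, (5.12.7) p.302] -/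
theorem fibreLaw_map_surfMul_cutoff [∀ b, IsProbabilityMeasure (m b)] {C : Finset (PBond P (k+1))}
    (hC : ∀ b : PBond P k, IsCross b → coarse b ∈ C → b ∈ D.Ib)
    (hm : ∀ b ∈ D.Ib, IsCross b → coarse b ∈ C → ∀ g : U1, (m b).map (· * g) = m b) (e : D.EU) (w : GaugeField P (k+1) U1) :
    (fibreLaw D m e).map (fun U => surfMul U (cutoff C w)) = fibreLaw D m e := by
  unfold fibreLaw
  rw [Measure.map_map (measurable_surfMul (cutoff C w)) (measurable_glueU D e)]
  have hcomp : ((fun U : GaugeField P k U1 => surfMul U (cutoff C w)) ∘ glueU D e) = glueU D e ∘ mulInt D C w :=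
    funext fun i => surfMul_glueU hC e i w
  have hmm : Measurable (mulInt D C w) := measurable_pi_iff.mpr fun b => ((measurable_pi_apply b).mul_const _)
  rw [hcomp, ← Measure.map_map (measurable_glueU D e) hmm, map_mulInt_μIU hm w]

/-- **`axialLaw` is right-invariant on surface bonds**: a surface (crossing) bond is not an axial tree bond ([2] (3.4): tree bonds stay inside their
block), so its one-bond law is the Haar measure `du_b`. [cite: BalabanImbrieJaffe1988, (3.11) p.266] -/
theorem axialLaw_map_mul_right {b : PBond P k} (hb : IsCross b) (g : U1) : (axialLaw P k b).map (· * g) = axialLaw P k b := by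
  have hnt : b ∉ (axialBonds : Finset (PBond P k)) := by
    intro h
    have h2 := (mem_axialBonds.1 h).2
    unfold BIJ85BlockAveragesTorus.IsCross at hb
    omega
  unfold BIJ88Eq5128Display.axialLaw
  rw [if_neg hnt]
  exact HaarData.map_mul_right g

/-- instance `m = axialLaw` (`ν = 𝒟u δ_{Ax}`): the glued fibre law is locally invariant under (i) alone. [cite: BalabanImbrieJaffe1988, (5.12.7) p.302] -/
theorem fibreLaw_axialLaw_map_surfMul_cutoff {C : Finset (PBond P (k+1))} (hC : ∀ b : PBond P k, IsCross b → coarse b ∈ C → b ∈ D.Ib)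
    (e : D.EU) (w : GaugeField P (k+1) U1) :
    (fibreLaw D (axialLaw P k) e).map (fun U => surfMul U (cutoff C w)) = fibreLaw D (axialLaw P k) e :=
  fibreLaw_map_surfMul_cutoff hC (fun _ _ hb _ g => axialLaw_map_mul_right hb g) e w

/-- instance `m = du` (`ν = 𝒟u`): the glued fibre law is locally invariant under (i) alone. [cite: BalabanImbrieJaffe1988, (5.12.8) p.303] -/
theorem fibreLaw_haar_map_surfMul_cutoff {C : Finset (PBond P (k+1))} (hC : ∀ b : PBond P k, IsCross b → coarse b ∈ C → b ∈ D.Ib)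
    (e : D.EU) (w : GaugeField P (k+1) U1) :
    (fibreLaw D (fun _ => (HaarData.haar : Measure U1)) e).map (fun U => surfMul U (cutoff C w)) =
      fibreLaw D (fun _ => (HaarData.haar : Measure U1)) e :=
  haveI : ∀ b : PBond P k, IsProbabilityMeasure ((fun _ : PBond P k => (HaarData.haar : Measure U1)) b) := fun _ => HaarData.isProb
  fibreLaw_map_surfMul_cutoff hC (fun _ _ _ _ g => HaarData.map_mul_right g) e w

variable [∀ b, IsProbabilityMeasure (m b)]

/-- **(4.6)/(5.12.7) ON THE INTERIOR FIBRE: `law(u′_C, cut-off_C·Qu) = law(u′_C) ⊗ (cut-off)_*dv` under the glued fibre law** — with the exterior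
variables frozen at any `e`, the translated interior configuration and the interior block averages are independent, the latter free Haar variables:
*"δ_{Λ′^{c*c}_{10}}(QΛ^{c*c}_{10}A″)"* at measure level, group level (standing range). [cite: BalabanImbrieJaffe1988, (5.12.7) p.302] -/
theorem map_graphCut_fibreLaw (hk : k + 1 ≤ P.m + P.K) {C : Finset (PBond P (k+1))}
    (hC : ∀ b : PBond P k, IsCross b → coarse b ∈ C → b ∈ D.Ib)
    (hm : ∀ b ∈ D.Ib, IsCross b → coarse b ∈ C → ∀ g : U1, (m b).map (· * g) = m b) (e : D.EU) :
    (fibreLaw D m e).map (fun U => (uCut qU C U, cutoff C (qU U))) =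
      ((fibreLaw D m e).map (uCut qU C)).prod ((fieldMeasure P (k+1) U1).map (cutoff C)) :=
  map_graphCut_eq_prod_local hk (fibreLaw_map_surfMul_cutoff hC hm e)

/-- **THE INTERIOR BLOCK AVERAGES INTEGRATE OUT (`ℝ≥0∞`)**: over the interior fibre with frozen exterior `e`,
`∫ F(u′_C(u_e(i)))·G(cut-off_C·Q(u_e(i))) dμIU(i) = (∫ F(u′_C(u_e(i))) dμIU(i)) · ∫dv G(cut-off_C·v)` (measurable `F, G ≥ 0`).
[cite: BalabanImbrieJaffe1988, (5.12.7) p.302] -/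
theorem lintegral_fibre_mul_comp_qU (hk : k + 1 ≤ P.m + P.K) {C : Finset (PBond P (k+1))}
    (hC : ∀ b : PBond P k, IsCross b → coarse b ∈ C → b ∈ D.Ib)
    (hm : ∀ b ∈ D.Ib, IsCross b → coarse b ∈ C → ∀ g : U1, (m b).map (· * g) = m b) (e : D.EU)
    {F : GaugeField P k U1 → ℝ≥0∞} (hF : Measurable F) {G : GaugeField P (k+1) U1 → ℝ≥0∞} (hG : Measurable G) :
    ∫⁻ i, F (uCut qU C (glueU D e i)) * G (cutoff C (qU (glueU D e i))) ∂D.μIU m =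
      (∫⁻ i, F (uCut qU C (glueU D e i)) ∂D.μIU m) * ∫⁻ v, G (cutoff C v) ∂fieldMeasure P (k+1) U1 := by
  have h := lintegral_mul_comp_qU_local (Λ := C) hk (fibreLaw_map_surfMul_cutoff hC hm e) hF hG
  have h1m : Measurable fun U : GaugeField P k U1 => F (uCut qU C U) * G (cutoff C (qU U)) :=
    (hF.comp (measurable_uCut C)).mul (hG.comp ((measurable_cutoff C).comp measurable_qU))
  have h2m : Measurable fun U : GaugeField P k U1 => F (uCut qU C U) := hF.comp (measurable_uCut C)
  rw [lintegral_fibreLaw D m e h1m, lintegral_fibreLaw D m e h2m] at h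
  exact h

/-- **THE INTERIOR BLOCK AVERAGES INTEGRATE OUT (Bochner, `ℂ`)**: same identity for measurable `F, G` with `F(u′_C(u_e(·)))` integrable over the fibre
and `G(cut-off_C·)` integrable against `dv`. [cite: BalabanImbrieJaffe1988, (5.12.7) p.302] -/
theorem integral_fibre_mul_comp_qU (hk : k + 1 ≤ P.m + P.K) {C : Finset (PBond P (k+1))}
    (hC : ∀ b : PBond P k, IsCross b → coarse b ∈ C → b ∈ D.Ib)
    (hm : ∀ b ∈ D.Ib, IsCross b → coarse b ∈ C → ∀ g : U1, (m b).map (· * g) = m b) (e : D.EU)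
    {F : GaugeField P k U1 → ℂ} (hF : Measurable F) {G : GaugeField P (k+1) U1 → ℂ} (hG : Measurable G) :
    ∫ i, F (uCut qU C (glueU D e i)) * G (cutoff C (qU (glueU D e i))) ∂D.μIU m =
      (∫ i, F (uCut qU C (glueU D e i)) ∂D.μIU m) * ∫ v, G (cutoff C v) ∂fieldMeasure P (k+1) U1 := by
  have h := integral_mul_comp_qU_local (Λ := C) hk (fibreLaw_map_surfMul_cutoff hC hm e) hF.aestronglyMeasurable hG.aestronglyMeasurable
  have h1m : Measurable fun U : GaugeField P k U1 => F (uCut qU C U) * G (cutoff C (qU U)) :=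
    (hF.comp (measurable_uCut C)).mul (hG.comp ((measurable_cutoff C).comp measurable_qU))
  have h2m : Measurable fun U : GaugeField P k U1 => F (uCut qU C U) := hF.comp (measurable_uCut C)
  rw [integral_fibreLaw D m e h1m.aestronglyMeasurable, integral_fibreLaw D m e h2m.aestronglyMeasurable] at h
  exact h

end Fibre

/-! ## §3 Bookkeeping: the term's translation on interior bonds -/

section Bookkeeping

variable {P : Params} {k : ℕ} (D : Interior P k)

/-- **On an interior bond the term's translation `u′_Λ` (cut-off `Λ ⊇ C`) agrees with `u′_C`** as soon as every interior surface bond whose block bond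
lies in `Λ` has it in `C` (the nesting `Λ^{(k)}_{10} ⊂ Λ^{(k)}_1` of p. 300: the interior constraints of the term are exactly those of `C =
Λ^{(k)′c*c}_{10}`). [cite: BalabanImbrieJaffe1988, (5.12.8) p.303] -/
theorem uCut_eq_uCut_of_mem {Λ C : Finset (PBond P (k+1))} (hΛC : ∀ b ∈ D.Ib, IsCross b → coarse b ∈ Λ → coarse b ∈ C) (hCΛ : C ⊆ Λ)
    (U : GaugeField P k U1) {b : PBond P k} (hb : b ∈ D.Ib) : uCut qU Λ U b = uCut qU C U b := by
  simp only [uCut_def, BIJ85BlockAveragesTorus.surfMul, BIJ85BlockAveragesTorus.surfFactor, cutoff_apply]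
  by_cases hc : IsCross b
  · simp only [if_pos hc]
    by_cases hΛ : coarse b ∈ Λ
    · rw [if_pos hΛ, if_pos (hΛC b hb hc hΛ)]
    · have hC : coarse b ∉ C := fun h => hΛ (hCΛ h)
      rw [if_neg hΛ, if_neg hC]
  · simp only [if_neg hc]

/-- **Off the interior, the term's translation ignores the interior substitution structure**: on an exterior bond `u′_Λ(u)_b = u_b · (factor)` with the
factor `(Q u)_{coarse b}⁻¹` or `1` — recorded as the pointwise formula for the consumer. [cite: BalabanImbrieJaffe1988, (5.3.1) p.280] -/
theorem uCut_apply (Λ : Finset (PBond P (k+1))) (U : GaugeField P k U1) (b : PBond P k) :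
    uCut qU Λ U b = U b * (if IsCross b then (if coarse b ∈ Λ then (qU U (coarse b))⁻¹ else 1) else 1) := by
  simp only [uCut_def, BIJ85BlockAveragesTorus.surfMul, BIJ85BlockAveragesTorus.surfFactor, cutoff_apply]

end Bookkeeping

end

end Literature.MathematicalPhysics.QuantumFieldTheory.BalabanImbrieJaffe1984to88.BIJ88InteriorFibration46
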